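import Mathlib
import HarnessLib
import Summits.Ventures.LatticeQCDFlow.Exactness.SU3SpectralCouplingLayerBooked
import Summits.Ventures.LatticeQCDFlow.Exactness.PolarCellJacobianSU3
import Summits.Ventures.LatticeQCDFlow.Exactness.PolarChartInverseSU3

/-!
# The `SU(3)` spectral kernel in the POLAR cell (`cell='polar'`, v0.3) is an exact transport of Haar with the booked density

HONEST FRAMING: exact (Metropolis-corrected) sampling algorithms for lattice gauge theory;
figures of merit are autocorrelation/cost numbers at stated couplings and volumes; no
continuum-physics claim.

Venture `LatticeQCDFlow` (cell pub-lqcd), topic `Exactness`; FANOUT row 10 (`eng-equiv`, engine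
`latflow.equiv` v0.3 `spectral_kernel(3, cell='polar')`: canonical cell point → polar box coordinates
(`polar3_from_x`) → box flow `χ` → back (`polar3_to_x`), `ldj = ld_chi + ld_polar_out − ld_polar_in +
log_haar(x') − log_haar(x)`; Abbott et al. 2305.02402 §4.1.1, named only).  NEW WORK of the cell: the
polar twin of `SU3SpectralKernelBookedBoxFlow` (the simplex cell).  It composes
`SU3SpectralCouplingLayerBooked.hasJacobian_spectralKernel_su3_booked` (kernel exact given an ALCOVE flow
with `HasJacobian (Leb|_A)`) with `PolarCellJacobianSU3.hasJacobian_alcove_of_polarBoxFlow_su3` (box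
flows in the polar cell are alcove flows with the booked correction) and the inverse chart of
`PolarChartInverseSU3` (to write the alcove flow `G = (Q∘T)∘χ∘(T⁻¹∘Q⁻¹)` and read the hypotheses at
`θ = (Q∘T)(a)`).  The auxiliary angle chart `E` and permutation action `P` are discharged
(`exists_angleChart_su3`, `exists_permDiag_family_su3`).  Nothing is cited as a fact; no number; no
definition.

* **`hasJacobian_spectralKernel_su3_booked_polarBoxFlow`** — `χ` a box flow on `B = (0,1)²` with
  `HasJacobian (Leb|_B) χ Jχ`, `χ(B) ⊆ B`; `f` measurable, permutation-equivariant, unimodular / unit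
  product, with `f(e^{ix(QTa)}) = e^{ix(QT(χa))}` on `B`; `h` following the recipe; `JD` a symmetric
  measurable spectral datum with the booked polar value
  `JD(e^{ix(QTa)})·|Δ|²/3! = (D(χa)·Jχ(a)/D(a))·|Δ'|²/3!`, `D = |det d(Q∘T)|`; `J W = JD d` in every
  diagonalization ⟹ `HasJacobian (Haar SU(3)) h J`.
-/

noncomputable section

namespace Summit.Ventures.LatticeQCDFlow.Exactness

open MeasureTheory Matrix Set Real
open Literature.LinearAlgebra.Matrix
open Literature.MathematicalPhysics.QuantumFieldTheory (haarProbability)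
open scoped ENNReal

section Polar

variable {T Q : (Fin 2 → ℝ) → (Fin 2 → ℝ)}
  (hT : ∀ a, T a = ![π / 3 * a 0, a 1 * (π / (Real.sqrt 3 * Real.cos (π / 3 * a 0 - π / 6)))])
  (hQ : ∀ z, Q z = ![-2 * z 1 * Real.cos (z 0), z 1 * Real.cos (z 0) - Real.sqrt 3 * z 1 * Real.sin (z 0)])

include hT hQ

/-- **The `SU(3)` spectral kernel in the polar cell is an exact transport of Haar with the booked
density.**  See the module docstring for the hypotheses; `D(a) = |(−2√3·(T a)₁)·((π/3)·π/(√3 cos(π/3·a₀ − π/6)))|`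
is the polar chart's Jacobian determinant. -/
theorem hasJacobian_spectralKernel_su3_booked_polarBoxFlow
    {f : (Fin 3 → ℂ) → (Fin 3 → ℂ)} (hfm : Measurable f)
    (hfperm : ∀ (σ : Equiv.Perm (Fin 3)) (d : Fin 3 → ℂ), (∀ i, ‖d i‖ = 1) →
      f (fun i => d (σ i)) = fun i => f d (σ i))
    {χ : (Fin 2 → ℝ) → (Fin 2 → ℝ)} {Jχ : (Fin 2 → ℝ) → ℝ≥0∞}
    (hχ : HasJacobian (volume.restrict (Set.pi univ fun _ : Fin 2 => Ioo (0 : ℝ) 1)) χ Jχ)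
    (hχbox : ∀ a ∈ Set.pi univ (fun _ : Fin 2 => Ioo (0 : ℝ) 1), χ a ∈ Set.pi univ fun _ : Fin 2 => Ioo (0 : ℝ) 1)
    (hfG : ∀ a ∈ Set.pi univ (fun _ : Fin 2 => Ioo (0 : ℝ) 1),
      f (fun i => (Circle.exp ((![(Q (T a)) 0, (Q (T a)) 1, -((Q (T a)) 0 + (Q (T a)) 1)] : Fin 3 → ℝ) i) : ℂ)) =
        fun i => (Circle.exp ((![(Q (T (χ a))) 0, (Q (T (χ a))) 1,
          -((Q (T (χ a))) 0 + (Q (T (χ a))) 1)] : Fin 3 → ℝ) i) : ℂ))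
    {h : Matrix.specialUnitaryGroup (Fin 3) ℂ → Matrix.specialUnitaryGroup (Fin 3) ℂ}
    (hagree : ∀ (W : Matrix.specialUnitaryGroup (Fin 3) ℂ) (V : Matrix (Fin 3) (Fin 3) ℂ) (d : Fin 3 → ℂ),
      V ∈ Matrix.unitaryGroup (Fin 3) ℂ → (W : Matrix (Fin 3) (Fin 3) ℂ) = V * diagonal d * star V →
        ((h W : Matrix.specialUnitaryGroup (Fin 3) ℂ) : Matrix (Fin 3) (Fin 3) ℂ) = V * diagonal (f d) * star V)
    (hf1 : ∀ d : Fin 3 → ℂ, (∀ i, ‖d i‖ = 1) → ∀ i, ‖f d i‖ = 1)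
    (hfdet : ∀ d : Fin 3 → ℂ, (∀ i, ‖d i‖ = 1) → ∏ i, d i = 1 → ∏ i, f d i = 1)
    {JD : (Fin 3 → ℂ) → ℝ≥0∞} (hJDm : Measurable JD)
    (hJDperm : ∀ (σ : Equiv.Perm (Fin 3)) (d : Fin 3 → ℂ), JD (fun i => d (σ i)) = JD d)
    (hJchart : ∀ a ∈ Set.pi univ (fun _ : Fin 2 => Ioo (0 : ℝ) 1),
      JD (fun i => (Circle.exp ((![(Q (T a)) 0, (Q (T a)) 1, -((Q (T a)) 0 + (Q (T a)) 1)] : Fin 3 → ℝ) i) : ℂ)) *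
          ENNReal.ofReal ((∏ i, ∏ k ∈ Finset.univ.erase i,
            ‖(Circle.exp ((![(Q (T a)) 0, (Q (T a)) 1, -((Q (T a)) 0 + (Q (T a)) 1)] : Fin 3 → ℝ) i) : ℂ) -
              (Circle.exp ((![(Q (T a)) 0, (Q (T a)) 1, -((Q (T a)) 0 + (Q (T a)) 1)] : Fin 3 → ℝ) k) : ℂ)‖) /
                (Fintype.card (Fin 3)).factorial) =
        (ENNReal.ofReal |(-2 * Real.sqrt 3 * (T (χ a)) 1) * (π / 3 * (π / (Real.sqrt 3 * Real.cos (π / 3 * (χ a) 0 - π / 6))))| *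
            Jχ a /
          ENNReal.ofReal |(-2 * Real.sqrt 3 * (T a) 1) * (π / 3 * (π / (Real.sqrt 3 * Real.cos (π / 3 * a 0 - π / 6))))|) *
          ENNReal.ofReal ((∏ i, ∏ k ∈ Finset.univ.erase i,
            ‖(Circle.exp ((![(Q (T (χ a))) 0, (Q (T (χ a))) 1, -((Q (T (χ a))) 0 + (Q (T (χ a))) 1)] : Fin 3 → ℝ) i) : ℂ) -
              (Circle.exp ((![(Q (T (χ a))) 0, (Q (T (χ a))) 1, -((Q (T (χ a))) 0 + (Q (T (χ a))) 1)] :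
                Fin 3 → ℝ) k) : ℂ)‖) / (Fintype.card (Fin 3)).factorial))
    {J : Matrix.specialUnitaryGroup (Fin 3) ℂ → ℝ≥0∞}
    (hJspec : ∀ (W : Matrix.specialUnitaryGroup (Fin 3) ℂ) (V : Matrix (Fin 3) (Fin 3) ℂ) (d : Fin 3 → ℂ),
      V ∈ Matrix.unitaryGroup (Fin 3) ℂ → (W : Matrix (Fin 3) (Fin 3) ℂ) = V * diagonal d * star V → J W = JD d) :
    HasJacobian (haarProbability (Matrix.specialUnitaryGroup (Fin 3) ℂ)) h J := by
  obtain ⟨E, -, hE⟩ := exists_angleChart_su3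
  obtain ⟨P, -, hP⟩ := exists_permDiag_family_su3
  -- the inverse charts
  set Ti : (Fin 2 → ℝ) → (Fin 2 → ℝ) := fun z => ![z 0 / (π / 3), z 1 / (π / (Real.sqrt 3 * Real.cos (z 0 - π / 6)))]
    with hTi'
  set Qi : (Fin 2 → ℝ) → (Fin 2 → ℝ) := fun θ => ![Real.arctan (((-θ 0 / 2 - θ 1) / Real.sqrt 3) / (-θ 0 / 2)),
    (-θ 0 / 2) * Real.sqrt (1 + (((-θ 0 / 2 - θ 1) / Real.sqrt 3) / (-θ 0 / 2)) ^ 2)] with hQi'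
  have hTi : ∀ z, Ti z = ![z 0 / (π / 3), z 1 / (π / (Real.sqrt 3 * Real.cos (z 0 - π / 6)))] := fun z => rfl
  have hQi : ∀ θ, Qi θ = ![Real.arctan (((-θ 0 / 2 - θ 1) / Real.sqrt 3) / (-θ 0 / 2)),
      (-θ 0 / 2) * Real.sqrt (1 + (((-θ 0 / 2 - θ 1) / Real.sqrt 3) / (-θ 0 / 2)) ^ 2)] := fun θ => rfl
  -- measurability of the charts and of the density
  have hm0 : Measurable fun a : Fin 2 → ℝ => a 0 := measurable_pi_apply 0
  have hm1 : Measurable fun a : Fin 2 → ℝ => a 1 := measurable_pi_apply 1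
  have hginv : Measurable fun a : Fin 2 → ℝ => π / (Real.sqrt 3 * Real.cos (π / 3 * a 0 - π / 6)) :=
    measurable_const.div (measurable_const.mul (Real.measurable_cos.comp ((hm0.const_mul _).sub measurable_const)))
  have hT0 : Measurable fun a : Fin 2 → ℝ => π / 3 * a 0 := hm0.const_mul _
  have hT1 : Measurable fun a : Fin 2 → ℝ => a 1 * (π / (Real.sqrt 3 * Real.cos (π / 3 * a 0 - π / 6))) := hm1.mul hginv
  have hcos0 : Measurable fun a : Fin 2 → ℝ => Real.cos (a 0) := Real.measurable_cos.comp hm0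
  have hsin0 : Measurable fun a : Fin 2 → ℝ => Real.sin (a 0) := Real.measurable_sin.comp hm0
  have hQ0 : Measurable fun z : Fin 2 → ℝ => -2 * z 1 * Real.cos (z 0) := (hm1.const_mul _).mul hcos0
  have hQ1 : Measurable fun z : Fin 2 → ℝ => z 1 * Real.cos (z 0) - Real.sqrt 3 * z 1 * Real.sin (z 0) :=
    (hm1.mul hcos0).sub ((hm1.const_mul _).mul hsin0)
  have hTi0 : Measurable fun z : Fin 2 → ℝ => z 0 / (π / 3) := hm0.div measurable_const
  have hTi1 : Measurable fun z : Fin 2 → ℝ => z 1 / (π / (Real.sqrt 3 * Real.cos (z 0 - π / 6))) :=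
    hm1.div (measurable_const.div (measurable_const.mul (Real.measurable_cos.comp (hm0.sub measurable_const))))
  have ht : Measurable fun θ : Fin 2 → ℝ => ((-θ 0 / 2 - θ 1) / Real.sqrt 3) / (-θ 0 / 2) :=
    (((hm0.neg.div measurable_const).sub hm1).div measurable_const).div (hm0.neg.div measurable_const)
  have hQi0 : Measurable fun θ : Fin 2 → ℝ => Real.arctan (((-θ 0 / 2 - θ 1) / Real.sqrt 3) / (-θ 0 / 2)) :=
    Real.measurable_arctan.comp ht
  have hQi1 : Measurable fun θ : Fin 2 → ℝ =>
      (-θ 0 / 2) * Real.sqrt (1 + (((-θ 0 / 2 - θ 1) / Real.sqrt 3) / (-θ 0 / 2)) ^ 2) :=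
    (hm0.neg.div measurable_const).mul (Real.continuous_sqrt.measurable.comp (measurable_const.add (ht.pow_const 2)))
  have hTm : Measurable T := by
    rw [show T = _ from funext hT]
    exact measurable_pi_lambda _ fun i => by
      fin_cases i
      · simpa using hT0
      · simpa using hT1
  have hQm : Measurable Q := by
    rw [show Q = _ from funext hQ]
    exact measurable_pi_lambda _ fun i => by
      fin_cases i
      · simpa using hQ0
      · simpa using hQ1
  have hTim : Measurable Ti := measurable_pi_lambda _ fun i => by
    fin_cases i
    · simpa [hTi'] using hTi0
    · simpa [hTi'] using hTi1
  have hQim : Measurable Qi := measurable_pi_lambda _ fun i => by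
    fin_cases i
    · simpa [hQi'] using hQi0
    · simpa [hQi'] using hQi1
  have hχm : Measurable χ := hχ.measurable
  have hJχm : Measurable Jχ := hχ.measurable_jac
  have hDm : Measurable fun a : Fin 2 → ℝ =>
      ENNReal.ofReal |(-2 * Real.sqrt 3 * (T a) 1) * (π / 3 * (π / (Real.sqrt 3 * Real.cos (π / 3 * a 0 - π / 6))))| :=
    ENNReal.measurable_ofReal.comp
      (((measurable_const.mul ((measurable_pi_apply 1).comp hTm)).mul (measurable_const.mul hginv)).abs)
  -- the alcove flow and its Jacobian
  set G : (Fin 2 → ℝ) → (Fin 2 → ℝ) := fun θ => Q (T (χ (Ti (Qi θ)))) with hG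
  set Dχ : (Fin 2 → ℝ) → ℝ≥0∞ := fun a =>
    ENNReal.ofReal |(-2 * Real.sqrt 3 * (T (χ a)) 1) * (π / 3 * (π / (Real.sqrt 3 * Real.cos (π / 3 * (χ a) 0 - π / 6))))| *
        Jχ a /
      ENNReal.ofReal |(-2 * Real.sqrt 3 * (T a) 1) * (π / 3 * (π / (Real.sqrt 3 * Real.cos (π / 3 * a 0 - π / 6))))|
    with hDχ
  set JA : (Fin 2 → ℝ) → ℝ≥0∞ := fun θ => Dχ (Ti (Qi θ)) with hJA
  have hGm : Measurable G := hQm.comp (hTm.comp (hχm.comp (hTim.comp hQim)))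
  have hDχm : Measurable Dχ := ((hDm.comp hχm).mul hJχm).div hDm
  have hJAm : Measurable JA := hDχm.comp (hTim.comp hQim)
  -- the points of the alcove in box coordinates
  have hbox : ∀ θ : Fin 2 → ℝ, θ 0 < θ 1 → θ 1 < -(θ 0 + θ 1) → -(θ 0 + θ 1) < θ 0 + 2 * π →
      Ti (Qi θ) ∈ Set.pi univ (fun _ : Fin 2 => Ioo (0 : ℝ) 1) ∧ Q (T (Ti (Qi θ))) = θ :=
    fun θ h0 h1 h2 => polarInv_mem_box_su3 hT hQ hTi hQi θ h0 h1 h2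
  -- `HasJacobian (Leb|_A) G JA` from the box flow through the polar chart
  have hGJ : HasJacobian ((volume : Measure (Fin 2 → ℝ)).restrict
      {θ : Fin 2 → ℝ | θ 0 < θ 1 ∧ θ 1 < -(θ 0 + θ 1) ∧ -(θ 0 + θ 1) < θ 0 + 2 * π}) G JA := by
    refine hasJacobian_alcove_of_polarBoxFlow_su3 hT hQ hχ hGm hJAm ?_ ?_
    · refine (ae_restrict_iff' measurableSet_openBox_two).mpr (Filter.Eventually.of_forall fun a ha => ?_)
      show Q (T (χ (Ti (Qi (Q (T a)))))) = Q (T (χ a))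
      rw [polarInv_polarChart_su3 hT hQ hTi hQi ha]
    · refine (ae_restrict_iff' measurableSet_openBox_two).mpr (Filter.Eventually.of_forall fun a ha => ?_)
      show Dχ (Ti (Qi (Q (T a)))) = _
      rw [polarInv_polarChart_su3 hT hQ hTi hQi ha]
  -- the hypotheses of the booked kernel theorem, read at `θ = Q(T a)`
  have hGA : ∀ θ : Fin 2 → ℝ, θ 0 < θ 1 → θ 1 < -(θ 0 + θ 1) → -(θ 0 + θ 1) < θ 0 + 2 * π →
      (G θ) 0 < (G θ) 1 ∧ (G θ) 1 < -((G θ) 0 + (G θ) 1) ∧ -((G θ) 0 + (G θ) 1) < (G θ) 0 + 2 * π := by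
    intro θ h0 h1 h2
    have hmem : Q (T (χ (Ti (Qi θ)))) ∈ (Q ∘ T) '' (Set.pi univ fun _ : Fin 2 => Ioo (0 : ℝ) 1) :=
      ⟨χ (Ti (Qi θ)), hχbox _ (hbox θ h0 h1 h2).1, rfl⟩
    rw [image_polarChart_su3 hT hQ] at hmem
    exact hmem
  have hfG' : ∀ θ : Fin 2 → ℝ, θ 0 < θ 1 → θ 1 < -(θ 0 + θ 1) → -(θ 0 + θ 1) < θ 0 + 2 * π →
      f (fun i => (Circle.exp ((![θ 0, θ 1, -(θ 0 + θ 1)] : Fin 3 → ℝ) i) : ℂ)) =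
        fun i => (Circle.exp ((![(G θ) 0, (G θ) 1, -((G θ) 0 + (G θ) 1)] : Fin 3 → ℝ) i) : ℂ) := by
    intro θ h0 h1 h2
    obtain ⟨ha, hθ⟩ := hbox θ h0 h1 h2
    have h := hfG _ ha
    rw [hθ] at h
    exact h
  have hJchart' : ∀ θ : Fin 2 → ℝ, θ 0 < θ 1 → θ 1 < -(θ 0 + θ 1) → -(θ 0 + θ 1) < θ 0 + 2 * π →
      JD (fun i => (Circle.exp ((![θ 0, θ 1, -(θ 0 + θ 1)] : Fin 3 → ℝ) i) : ℂ)) * ENNReal.ofReal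
          ((∏ i, ∏ k ∈ Finset.univ.erase i,
            ‖(Circle.exp ((![θ 0, θ 1, -(θ 0 + θ 1)] : Fin 3 → ℝ) i) : ℂ) -
              (Circle.exp ((![θ 0, θ 1, -(θ 0 + θ 1)] : Fin 3 → ℝ) k) : ℂ)‖) / (Fintype.card (Fin 3)).factorial) =
        JA θ * ENNReal.ofReal
          ((∏ i, ∏ k ∈ Finset.univ.erase i,
            ‖(Circle.exp ((![(G θ) 0, (G θ) 1, -((G θ) 0 + (G θ) 1)] : Fin 3 → ℝ) i) : ℂ) -
              (Circle.exp ((![(G θ) 0, (G θ) 1, -((G θ) 0 + (G θ) 1)] : Fin 3 → ℝ) k) : ℂ)‖) /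
                (Fintype.card (Fin 3)).factorial) := by
    intro θ h0 h1 h2
    obtain ⟨ha, hθ⟩ := hbox θ h0 h1 h2
    have h := hJchart _ ha
    rw [hθ] at h
    exact h
  exact hasJacobian_spectralKernel_su3_booked hE hP hfm hfperm hGJ hGA hfG' hagree hf1 hfdet hJDm hJDperm hJchart' hJspec

end Polar

end Summit.Ventures.LatticeQCDFlow.Exactness
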